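import Literature.Geometry.Lorentzian.VolumeChartIntegral
import HarnessLib

/-!
# Riemannian measures with proportional chart densities: `dμ_{h₁} = ρ dμ_{h₂}`
(topic `Geometry/Lorentzian`, companion of `Volume.lean` / `VolumeChartIntegral.lean`)

Two `C^n` Riemannian metrics `h₁, h₂` on the same manifold `N` (modelled on `ℝ^m`) have mutually
absolutely continuous Riemannian measures, and the Radon–Nikodym density is the ratio of the
volume densities: if a function `ρ : N → [0, ∞]` satisfies, in every extended chart `φ = φ_x` and
at every point `y` of its target,
`√(det (h₁)_{ij}(y)) = ρ(φ⁻¹ y) · √(det (h₂)_{ij}(y))`,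
then `μ_{h₁} = ρ · μ_{h₂}` (`riemannianMeasure_eq_withDensity_of_chartGram`; real-valued form
`riemannianMeasure_eq_withDensity_ofReal_of_chartGram`). This is the measure-theoretic form of
"`dV_{g₁} = (dV_{g₁}/dV_{g₂}) dV_{g₂}`, the ratio of the volume forms being the function
`√(det g₁ / det g₂)`" used whenever a volume is differentiated along a family of metrics (Topping
2006, Prop. 2.3.12: `∂ₜ dV = ½ (tr ∂ₜg) dV`; Chavel 2006, §III.3, (III.3.5) `dV = √g dx`): on a
measurable subset of a chart domain both sides are the chart integral `∫ ρ(φ⁻¹ y) √det (h₂)_{ij} dy`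
(`riemannianMeasure_eq_integral_sqrt_det_holds` for `h₁`, `lintegral_eq_lintegral_chart` for
`h₂`), and a finite chart cover of the compact manifold concludes. The constant case `ρ ≡ c` is
`riemannianMeasure_eq_ofReal_mul_of_chartGram` (`InverseMeanCurvatureFlowArea.lean`).
Everything is proved; no definitions.

## References

* I. Chavel, *Riemannian Geometry: A Modern Introduction*, 2nd ed., CUP 2006, §III.3,
  (III.3.5)–(III.3.6). [Chavel2006]
* P. Topping, *Lectures on the Ricci flow*, LMS Lecture Note Series 325, CUP 2006, Prop. 2.3.12
  (p. 25). [Topping2006]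
* H. Federer, *Geometric Measure Theory*, Springer 1969, §3.2.46. [Federer1969]
-/

noncomputable section

open Manifold Bundle MeasureTheory Set Filter Function
open scoped ContDiff Topology ENNReal

namespace Literature.Geometry.Lorentzian

variable {H : Type*} [TopologicalSpace H] {n : ℕ∞ω} {m : ℕ}
  {I : ModelWithCorners ℝ (EuclideanSpace ℝ (Fin m)) H}
  {N : Type*} [TopologicalSpace N] [ChartedSpace H N] [IsManifold I 1 N] [T3Space N]
  [MeasurableSpace N] [BorelSpace N]

/-- **Chart-local form.** If `√det (h₁)_{ij}(y) = ρ(φ⁻¹ y) √det (h₂)_{ij}(y)` on the target of the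
extended chart `φ` at `x` (as an identity in `[0, ∞]`), then `μ_{h₁}(A) = ∫_A ρ dμ_{h₂}` for every
measurable `A ⊆ φ.source`: both sides equal `∫_{φ A} ρ(φ⁻¹ y) √det (h₂)_{ij}(y) dy`.
[cite: Chavel2006, §III.3 (III.3.5)–(III.3.6)] -/
theorem riemannianMeasure_eq_withDensity_apply_of_subset_source
    (h₁ h₂ : ContMDiffRiemannianMetric I n (EuclideanSpace ℝ (Fin m)) (TangentSpace I : N → Type _))
    {ρ : N → ℝ≥0∞} (hρ : Measurable ρ) (x : N)
    (hpt : ∀ y ∈ (extChartAt I x).target,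
      ENNReal.ofReal (Real.sqrt (chartGramMatrix h₁ x y).det) =
        ρ ((extChartAt I x).symm y) * ENNReal.ofReal (Real.sqrt (chartGramMatrix h₂ x y).det))
    {A : Set N} (hA : MeasurableSet A) (hAx : A ⊆ (extChartAt I x).source) :
    riemannianMeasure h₁ A = (riemannianMeasure h₂).withDensity ρ A := by
  have hsub : extChartAt I x '' A ⊆ (extChartAt I x).target := by
    rintro y ⟨z, hz, rfl⟩
    exact (extChartAt I x).map_source (hAx hz)
  have hB : MeasurableSet (extChartAt I x '' A) := measurableSet_image_extChartAt x hA hAx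
  rw [riemannianMeasure_eq_integral_sqrt_det_holds h₁ x hA hAx, withDensity_apply _ hA,
    ← lintegral_indicator hA,
    lintegral_eq_lintegral_chart h₂ x (hρ.indicator hA) (support_indicator_subset.trans hAx)]
  -- both sides are `∫_{φ A} ρ(φ⁻¹ y) √det (h₂)_{ij} dy`
  have hR : ∫⁻ y in (extChartAt I x).target, A.indicator ρ ((extChartAt I x).symm y) *
        ENNReal.ofReal (Real.sqrt (chartGramMatrix h₂ x y).det) =
      ∫⁻ y in (extChartAt I x).target, (extChartAt I x '' A).indicator
        (fun y ↦ ρ ((extChartAt I x).symm y) *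
          ENNReal.ofReal (Real.sqrt (chartGramMatrix h₂ x y).det)) y := by
    refine setLIntegral_congr_fun (measurableSet_extChartAt_target x) fun y hy ↦ ?_
    by_cases hyA : (extChartAt I x).symm y ∈ A
    · have hyB : y ∈ extChartAt I x '' A :=
        ⟨(extChartAt I x).symm y, hyA, (extChartAt I x).right_inv hy⟩
      rw [indicator_of_mem hyA, indicator_of_mem hyB]
    · have hyB : y ∉ extChartAt I x '' A := by
        rintro ⟨z, hz, rfl⟩
        exact hyA (by rwa [(extChartAt I x).left_inv (hAx hz)])
      rw [indicator_of_notMem hyA, indicator_of_notMem hyB, zero_mul]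
  rw [hR, lintegral_indicator hB, Measure.restrict_restrict hB, inter_eq_left.2 hsub]
  exact setLIntegral_congr_fun hB fun y hy ↦ hpt y (hsub hy)

/-- **Riemannian measures with proportional chart densities** (`dμ_{h₁} = ρ dμ_{h₂}`). On a
compact manifold modelled on `ℝ^m`, let `h₁, h₂` be `C^n` Riemannian metrics and `ρ : N → [0, ∞]`
measurable with `√det (h₁)_{ij}(y) = ρ(φ⁻¹ y) · √det (h₂)_{ij}(y)` at every point `y` of the target
of every extended chart `φ = φ_x`. Then `μ_{h₁} = μ_{h₂}.withDensity ρ` (chart-local form on the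
measurable pieces of a finite chart cover, and additivity). The ratio of the volume densities of two
metrics is a function on the manifold (independent of the chart), so this is
`dV_{g₁} = √(det g₁/det g₂) dV_{g₂}`; Topping 2006, Prop. 2.3.12 differentiates it in a family.
[cite: Chavel2006, §III.3 (III.3.5)–(III.3.6)] [cite: Topping2006, Prop. 2.3.12 (p. 25)] -/
theorem riemannianMeasure_eq_withDensity_of_chartGram [CompactSpace N]
    (h₁ h₂ : ContMDiffRiemannianMetric I n (EuclideanSpace ℝ (Fin m)) (TangentSpace I : N → Type _))
    {ρ : N → ℝ≥0∞} (hρ : Measurable ρ)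
    (hpt : ∀ (x : N) (y : EuclideanSpace ℝ (Fin m)), y ∈ (extChartAt I x).target →
      ENNReal.ofReal (Real.sqrt (chartGramMatrix h₁ x y).det) =
        ρ ((extChartAt I x).symm y) * ENNReal.ofReal (Real.sqrt (chartGramMatrix h₂ x y).det)) :
    riemannianMeasure h₁ = (riemannianMeasure h₂).withDensity ρ := by
  classical
  refine Measure.ext fun s hs ↦ ?_
  obtain ⟨T, hT⟩ := isCompact_univ.elim_finite_subcover (fun x : N ↦ (extChartAt I x).source)
    (fun x ↦ isOpen_extChartAt_source x) (fun x _ ↦ mem_iUnion.2 ⟨x, mem_extChartAt_source x⟩)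
  suffices key : ∀ (T : Finset N) (A : Set N), MeasurableSet A →
      A ⊆ (⋃ x ∈ T, (extChartAt I x).source) →
        riemannianMeasure h₁ A = (riemannianMeasure h₂).withDensity ρ A from
    key T s hs fun z hz ↦ hT (mem_univ z)
  intro T
  induction T using Finset.induction_on with
  | empty =>
    intro A _ hAT
    have hA0 : A = ∅ := subset_empty_iff.1 (by simpa using hAT)
    subst hA0
    simp
  | insert x T hxT ih =>
    intro A hAm hAT
    have hsrc : MeasurableSet (extChartAt I x).source := (isOpen_extChartAt_source x).measurableSet
    have hsplit : A = (A ∩ (extChartAt I x).source) ∪ (A \ (extChartAt I x).source) :=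
      (inter_union_sdiff _ _).symm
    have hdisj : Disjoint (A ∩ (extChartAt I x).source) (A \ (extChartAt I x).source) :=
      disjoint_left.2 fun z hz hz' ↦ hz'.2 hz.2
    have hrest : A \ (extChartAt I x).source ⊆ ⋃ y ∈ T, (extChartAt I y).source := by
      intro z hz
      have hz' := hAT hz.1
      rw [Finset.set_biUnion_insert, mem_union] at hz'
      exact hz'.resolve_left hz.2
    rw [hsplit, measure_union hdisj (hAm.diff hsrc), measure_union hdisj (hAm.diff hsrc),
      riemannianMeasure_eq_withDensity_apply_of_subset_source h₁ h₂ hρ x (hpt x) (hAm.inter hsrc)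
        inter_subset_right, ih _ (hAm.diff hsrc) hrest]

/-- **Real-valued form**: if `ρ : N → ℝ` is measurable and nonnegative with
`√det (h₁)_{ij}(y) = ρ(φ⁻¹ y) · √det (h₂)_{ij}(y)` on every chart target, then
`μ_{h₁} = μ_{h₂}.withDensity (ENNReal.ofReal ∘ ρ)`; in particular
`∫ f dμ_{h₁} = ∫ ρ f dμ_{h₂}` by the `withDensity` calculus of Mathlib.
[cite: Chavel2006, §III.3 (III.3.5)–(III.3.6)] -/
theorem riemannianMeasure_eq_withDensity_ofReal_of_chartGram [CompactSpace N]
    (h₁ h₂ : ContMDiffRiemannianMetric I n (EuclideanSpace ℝ (Fin m)) (TangentSpace I : N → Type _))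
    {ρ : N → ℝ} (hρ : Measurable ρ) (hρ₀ : ∀ p, 0 ≤ ρ p)
    (hpt : ∀ (x : N) (y : EuclideanSpace ℝ (Fin m)), y ∈ (extChartAt I x).target →
      Real.sqrt (chartGramMatrix h₁ x y).det =
        ρ ((extChartAt I x).symm y) * Real.sqrt (chartGramMatrix h₂ x y).det) :
    riemannianMeasure h₁ = (riemannianMeasure h₂).withDensity (fun p ↦ ENNReal.ofReal (ρ p)) :=
  riemannianMeasure_eq_withDensity_of_chartGram h₁ h₂ (ENNReal.measurable_ofReal.comp hρ)
    fun x y hy ↦ by rw [hpt x y hy, ENNReal.ofReal_mul (hρ₀ _)]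

/-- Under the same hypotheses the total measures compare through the density:
`μ_{h₁}(A) = ∫_A ρ dμ_{h₂}` for measurable `A`. [cite: Chavel2006, §III.3 (III.3.5)–(III.3.6)] -/
theorem riemannianMeasure_apply_eq_setLIntegral_of_chartGram [CompactSpace N]
    (h₁ h₂ : ContMDiffRiemannianMetric I n (EuclideanSpace ℝ (Fin m)) (TangentSpace I : N → Type _))
    {ρ : N → ℝ} (hρ : Measurable ρ) (hρ₀ : ∀ p, 0 ≤ ρ p)
    (hpt : ∀ (x : N) (y : EuclideanSpace ℝ (Fin m)), y ∈ (extChartAt I x).target →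
      Real.sqrt (chartGramMatrix h₁ x y).det =
        ρ ((extChartAt I x).symm y) * Real.sqrt (chartGramMatrix h₂ x y).det)
    {A : Set N} (hA : MeasurableSet A) :
    riemannianMeasure h₁ A = ∫⁻ p in A, ENNReal.ofReal (ρ p) ∂riemannianMeasure h₂ := by
  rw [riemannianMeasure_eq_withDensity_ofReal_of_chartGram h₁ h₂ hρ hρ₀ hpt, withDensity_apply _ hA]

end Literature.Geometry.Lorentzian

end
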